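import Summits.NavierStokesRegularity.FluidComputer.PalasekTowerHeredityWitnessUnconditional
import Literature.Analysis.FluidPDE.SerrinEnstrophyGronwallForced
import Literature.Analysis.FluidPDE.ClayForceTimeShift
import Literature.Analysis.FluidPDE.TaoLocalisationContinuation
import HarnessLib

/-!
# Crossing the end of a forced era, I: one restarted piece (existence is Tao's forced local
# theory; identification with the flow is W14-free uniqueness; enstrophy control is forced
# Serrin–Grönwall at `r = ∞` under the flow's own bound)

Cell `ns-blowup`, seat `ns-blowup-ecbridge-1` (g5). LABEL: E–C typing + kernel analysis. WHAT THIS IS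
NOT: not Navier–Stokes evidence — conditional plumbing for the stub `LocalContinuationAt k` of the
child crux `HeredityAtOne` (route `PalasekTowerBreakdown`); no stage, flow or tower is constructed.

THE PROBLEM (ecbridge-7, `PalasekTowerRegisterGlobalEnvelopeAt`): a registered stage at level `k` is
a classical solution of the FORCED system on the closed slab `[0, τ k]`; at `k ≤ 1` no tree theorem
continues it past `τ k` (the unforced continuation theory restarts from an UNFORCED classical
solution on a slab of positive length, which exists only for `k ≥ 2`). The missing input is forced
local well-posedness on `ℝ³` — now the named fact
`Literature.Analysis.FluidPDE.tao2011_smooth_local_existence_forced` (Tao 2013, Thm. 5.4 (ii)+(iv)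
with forcing; the forced twin of the DISCHARGED `tao2011_smooth_local_existence`).

THE ARGUMENT (this file = the pieces; `ForcedClassicalContinuation` = the loop). Let `(u, p)` be
classical on `[0, τ]` with a Clay-class force `f`, finite energy, `‖u‖ ≤ M`, Schwartz datum. A PIECE
restarted at `t₀ ∈ [0, τ]` is Tao's forced smooth solution on `[0, h]` from the `H^∞` slice `u(t₀)`
with the shifted force `f(· + t₀)` (Clay class again: `ClayForceTimeShift`). (1) `piece_eq_shift`:
the piece IS the flow `u(· + t₀)` as long as both live — the flow is the bounded competitor of
ecbridge-6's W14-free `velocity_eq_of_bounded_classical` (forced Serrin–Masuda, tree theorem).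
(2) `piece_enstrophy_le`: hence the piece is bounded by `M`, i.e. in the Serrin class `r = ∞`, and
the tree theorem `enstrophy_le_of_serrin_forced_uniform` (Lemarié-Rieusset 2016, (11.11)) bounds
`∫|∇w(s)|² ≤ e^{κ M² h} (∫|∇w(0)|² + ν⁻¹ C₀ h)` — the piece is in Tao's class, so the inequality is
legitimate, which is exactly what the bare stage does not offer. (3) `loop_step_bound`,
`loop_bound_le_uniform`: the resulting recursion `K_{n+1} ≤ e^{κM²h}(K_n + ν⁻¹C₀h)` stays below
`e^{2κM²τ}(K₀ + 2τν⁻¹C₀)` while `n h ≤ 2τ` — a UNIFORM `H¹` radius, hence a uniform lifespan `h`.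
Also `exists_force_slice_bounds` (the `H¹`-type slice bounds of a Clay force in the shape of the
fact's hypotheses).

References: T. Tao, Anal. PDE 6 (2013), Thm. 5.4 [cite: Tao2011, Thm. 5.4 (ii)+(iv)];
P. G. Lemarié-Rieusset, *The Navier–Stokes Problem in the 21st Century* (2016), Thm. 11.2 (11.11)
[cite: LemarieRieusset2016, Thm. 11.2 (11.11)]; H. Sohr, *The Navier–Stokes Equations* (2001),
Ch. V Thm. 1.5.1 [cite: Sohr2001, Ch. V Thm. 1.5.1].
-/

noncomputable section

open MeasureTheory Set Function Filter Topology
open scoped ENNReal NNReal ContDiff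

namespace Summit.NavierStokesRegularity.FluidComputer.PalasekTowerClayBridge

open Literature.Analysis.FluidPDE

namespace ForcedContinuation

/-! ## §1 Slices of a Clay-class force: the `H¹`-type bounds of Tao's hypotheses -/

/-- The energy of a field is the `L²` norm of its `0`-th derivative (`‖D⁰v‖ = ‖v‖`) (private copy of
a tree lemma, kept local to avoid a heavy import). [folklore] -/
private theorem lintegral_enorm_sq_eq_iteratedFDeriv_zero
    (v : EuclideanSpace ℝ (Fin 3) → EuclideanSpace ℝ (Fin 3)) :
    ∫⁻ x, ‖v x‖ₑ ^ 2 = ∫⁻ x, ‖iteratedFDeriv ℝ 0 v x‖ₑ ^ 2 :=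
  lintegral_congr fun x => by rw [← ofReal_norm, ← ofReal_norm, norm_iteratedFDeriv_zero]

/-- **Uniform `H¹`-type slice bounds of a Clay-class force**, in the shape of the hypotheses of
`tao2011_smooth_local_existence_forced` and of `enstrophy_le_of_serrin_forced_uniform`: there are
`C₀` (energy of the slices) and `B ≥ 0` with `∫‖f t‖² ≤ C₀` and `∫‖f t‖² + ∫|∇f t|²_F ≤ B²` for all
`t ≥ 0`, and every slice has `∫‖Dʲ(f t)‖² ≤ C₁` for `j ≤ 1` ("Schwartz forcing is `L^∞_t H¹_x`",
Tao 2013, §1 p. 3). [cite: Tao2011, §1 p. 3] -/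
theorem exists_force_slice_bounds {f : ℝ → EuclideanSpace ℝ (Fin 3) → EuclideanSpace ℝ (Fin 3)}
    (hs : IsSmoothOnHalfSpace f) (hd : HasRapidSpaceTimeDecay f) :
    ∃ (C₀ C₁ : ℝ≥0) (B : ℝ), 0 ≤ B ∧
      (∀ t, 0 ≤ t → ∫⁻ x, ‖f t x‖ₑ ^ 2 ≤ C₀) ∧
      (∀ t, 0 ≤ t → ∫⁻ x, ‖iteratedFDeriv ℝ 1 (f t) x‖ₑ ^ 2 ≤ C₁) ∧
      (∀ t, 0 ≤ t →
        (∫⁻ x, ‖f t x‖ₑ ^ 2) + (∫⁻ x, ENNReal.ofReal (frobeniusNormSq (fderiv ℝ (f t) x))) ≤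
          ENNReal.ofReal (B ^ 2)) := by
  have h := hd.exists_lintegral_iteratedFDeriv_slice_sq_le (μ := (volume : Measure _)) hs
  obtain ⟨C₀, hC₀⟩ := h 0 (by norm_num)
  obtain ⟨C₁, hC₁⟩ := h 1 le_rfl
  have hC₀' : ∀ t, 0 ≤ t → ∫⁻ x, ‖f t x‖ₑ ^ 2 ≤ C₀ := fun t ht => by
    rw [lintegral_enorm_sq_eq_iteratedFDeriv_zero]; exact hC₀ t ht
  refine ⟨C₀, C₁, Real.sqrt ((C₀ : ℝ) + 3 * C₁), Real.sqrt_nonneg _, hC₀', hC₁, fun t ht => ?_⟩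
  rw [Real.sq_sqrt (by positivity)]
  have h3 : ∫⁻ x, ENNReal.ofReal (frobeniusNormSq (fderiv ℝ (f t) x)) ≤ 3 * (C₁ : ℝ≥0∞) :=
    (lintegral_frobeniusNormSq_le_three_mul_iteratedFDeriv_one _).trans (by gcongr; exact hC₁ t ht)
  calc (∫⁻ x, ‖f t x‖ₑ ^ 2) + (∫⁻ x, ENNReal.ofReal (frobeniusNormSq (fderiv ℝ (f t) x)))
      ≤ (C₀ : ℝ≥0∞) + 3 * (C₁ : ℝ≥0∞) := add_le_add (hC₀' t ht) h3
    _ = ENNReal.ofReal ((C₀ : ℝ) + 3 * C₁) := by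
        rw [ENNReal.ofReal_add (by positivity) (by positivity), ENNReal.ofReal_coe_nnreal,
          ENNReal.ofReal_mul (by norm_num), ENNReal.ofReal_coe_nnreal]
        norm_num

/-! ## §2 One restarted piece: existence (the named fact), identification with the flow
(W14-free uniqueness under the flow's bound), enstrophy control (forced Serrin–Grönwall at
`r = ∞`) -/

section Piece

variable {ν τ M : ℝ} {f u : ℝ → EuclideanSpace ℝ (Fin 3) → EuclideanSpace ℝ (Fin 3)}
  {p : ℝ → EuclideanSpace ℝ (Fin 3) → ℝ}

/-- **The flow shifted to a restart time** `t₀ ∈ [0, τ]`: `(u, p)(· + t₀)` is a classical solution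
with the shifted force on `[0, τ - t₀']` for every `0 < τ' ` with `t₀ + τ' ≤ τ`. [folklore] -/
theorem shift_classical (hu : IsClassicalNSSolutionOn (Icc 0 τ) ν f u p) {t₀ τ' : ℝ}
    (ht₀ : 0 ≤ t₀) (hτ' : 0 < τ') (hle : t₀ + τ' ≤ τ) :
    IsClassicalNSSolutionOn (Icc 0 τ') ν (fun s => f (s + t₀)) (fun s => u (s + t₀))
      (fun s => p (s + t₀)) :=
  (hu.comp_add_right t₀).mono (fun s hs => ⟨by linarith [hs.1], by linarith [hs.2]⟩)
    (uniqueDiffOn_Icc hτ')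

/-- Finite energy of the shifted flow. [folklore] -/
theorem shift_energy (hE : ∃ C : ℝ≥0∞, C < ⊤ ∧ ∀ t ∈ Icc 0 τ, ∫⁻ x, ‖u t x‖ₑ ^ 2 ≤ C)
    {t₀ τ' : ℝ} (ht₀ : 0 ≤ t₀) (hle : t₀ + τ' ≤ τ) :
    ∃ C : ℝ≥0∞, C < ⊤ ∧ ∀ t ∈ Icc 0 τ', ∫⁻ x, ‖(fun s => u (s + t₀)) t x‖ₑ ^ 2 ≤ C := by
  obtain ⟨C, hC, hb⟩ := hE
  exact ⟨C, hC, fun t ht => hb (t + t₀) ⟨by linarith [ht.1], by linarith [ht.2]⟩⟩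

/-- **A restarted piece IS the flow** (W14-free): a classical finite-energy solution `(w, q)` on
`[0, T]` with the shifted force from the datum `u(t₀)` coincides with `u(· + t₀)` on `[0, τ']`
whenever `0 < τ' ≤ T` and `t₀ + τ' ≤ τ` — the flow is the bounded competitor
(`velocity_eq_of_bounded_classical`, forced Serrin–Masuda; the shifted force is Clay-class by
`HasRapidSpaceTimeDecay.timeShift`). [cite: Sohr2001, Ch. V Thm. 1.5.1] -/
theorem piece_eq_shift (hν : 0 < ν) (hs : IsSmoothOnHalfSpace f) (hd : HasRapidSpaceTimeDecay f)
    (hu : IsClassicalNSSolutionOn (Icc 0 τ) ν f u p)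
    (hE : ∃ C : ℝ≥0∞, C < ⊤ ∧ ∀ t ∈ Icc 0 τ, ∫⁻ x, ‖u t x‖ₑ ^ 2 ≤ C)
    (hM : ∀ t ∈ Icc 0 τ, ∀ x, ‖u t x‖ ≤ M) {t₀ τ' T : ℝ} (ht₀ : 0 ≤ t₀) (hτ' : 0 < τ')
    (hle : t₀ + τ' ≤ τ) (hτ'T : τ' ≤ T)
    {w : ℝ → EuclideanSpace ℝ (Fin 3) → EuclideanSpace ℝ (Fin 3)}
    {q : ℝ → EuclideanSpace ℝ (Fin 3) → ℝ}
    (hw : IsClassicalNSSolutionOn (Icc 0 T) ν (fun s => f (s + t₀)) w q)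
    (hEw : ∃ C : ℝ≥0∞, C < ⊤ ∧ ∀ t ∈ Icc 0 T, ∫⁻ x, ‖w t x‖ₑ ^ 2 ≤ C) (hw0 : w 0 = u t₀) :
    ∀ s ∈ Icc 0 τ', w s = u (s + t₀) := by
  have hwr : IsClassicalNSSolutionOn (Icc 0 τ') ν (fun s => f (s + t₀)) w q :=
    hw.mono (Icc_subset_Icc le_rfl hτ'T) (uniqueDiffOn_Icc hτ')
  have hEwr : ∃ C : ℝ≥0∞, C < ⊤ ∧ ∀ t ∈ Icc 0 τ', ∫⁻ x, ‖w t x‖ₑ ^ 2 ≤ C := by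
    obtain ⟨C, hC, hb⟩ := hEw
    exact ⟨C, hC, fun t ht => hb t ⟨ht.1, ht.2.trans hτ'T⟩⟩
  have hB : ∀ t ∈ Icc 0 τ', ∀ x, ‖(fun s => u (s + t₀)) t x‖ ≤ M := fun t ht x =>
    hM (t + t₀) ⟨by linarith [ht.1], by linarith [ht.2]⟩ x
  exact velocity_eq_of_bounded_classical hν hτ' (hs.timeShift ht₀) (hd.timeShift hs ht₀)
    (shift_classical hu ht₀ hτ' hle) (shift_energy hE ht₀ hle) hB hwr hEwr (by simpa using hw0)

/-- The `L^∞` norm of a slice bounded pointwise by `M ≥ 0` is at most `M`. [folklore] -/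
theorem eLpNorm_top_le_of_bound {v : EuclideanSpace ℝ (Fin 3) → EuclideanSpace ℝ (Fin 3)}
    (hv : ∀ x, ‖v x‖ ≤ M) : eLpNorm v ⊤ volume ≤ ENNReal.ofReal M := by
  rw [eLpNorm_exponent_top]
  exact eLpNormEssSup_le_of_ae_bound (Filter.Eventually.of_forall hv)

/-- The one-sided time derivatives of a jointly smooth field within a sub-slab `[0, T']` of
`[0, T]` are those within `[0, T]` (slices as functions of `x`). [folklore] -/
theorem timeDerivWithin_sub_slab {w : ℝ → EuclideanSpace ℝ (Fin 3) → EuclideanSpace ℝ (Fin 3)}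
    {T T' : ℝ} (hw : IsSmoothSpaceTimeOn (Icc 0 T) w) (hT' : 0 < T') (hT'T : T' ≤ T) {t : ℝ}
    (ht : t ∈ Icc 0 T') :
    timeDerivWithin (Icc 0 T') w t = timeDerivWithin (Icc 0 T) w t := by
  funext x
  exact hw.timeDerivWithin_eq_of_subset (Icc_subset_Icc le_rfl hT'T) (uniqueDiffOn_Icc hT') ht x

/-- **Enstrophy control of a piece that stays inside the forced era** (forced Serrin–Grönwall at
the endpoint `r = ∞`, the tree theorem `enstrophy_le_of_serrin_forced_uniform`): a Tao-class
classical solution `(w, q)` on `[0, h]` with the shifted Clay force, bounded by `M` on `[0, h] × ℝ³`,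
has `∫|∇w(s)|² ≤ exp(κ_ν · ∫₀ʰ ‖w‖²_∞) (∫|∇w(0)|² + ν⁻¹ C₀ h)` for `s < h`, where
`C₀ ≥ sup_t ∫‖f t‖²` and `κ_ν` is the absolute Serrin–Grönwall rate at `θ = 1`; with
`∫₀ʰ ‖w‖²_∞ ≤ M² h`. Stated with the rate as it comes out of the tree theorem.
[cite: LemarieRieusset2016, Thm. 11.2 (11.11)] -/
theorem piece_enstrophy_le (hν : 0 < ν)
    {C₀ C₁ : ℝ≥0} (hC₀ : ∀ t, 0 ≤ t → ∫⁻ x, ‖f t x‖ₑ ^ 2 ≤ C₀)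
    (hC₁ : ∀ t, 0 ≤ t → ∫⁻ x, ‖iteratedFDeriv ℝ 1 (f t) x‖ₑ ^ 2 ≤ C₁)
    {t₀ h : ℝ} (ht₀ : 0 ≤ t₀) (hh : 0 < h) (hM0 : 0 ≤ M)
    {w : ℝ → EuclideanSpace ℝ (Fin 3) → EuclideanSpace ℝ (Fin 3)}
    {q : ℝ → EuclideanSpace ℝ (Fin 3) → ℝ}
    (hw : IsClassicalNSSolutionOn (Icc 0 h) ν (fun s => f (s + t₀)) w q)
    (hwS : HasBoundedSobolevNormsOn (Icc 0 h) w)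
    (hwS' : HasBoundedSobolevNormsOn (Icc 0 h) (timeDerivWithin (Icc 0 h) w))
    (hqS : ∀ n : ℕ, ∃ C : ℝ≥0, ∀ t ∈ Icc 0 h, ∫⁻ x, ‖iteratedFDeriv ℝ n (q t) x‖ₑ ^ 2 ≤ C)
    (hwM : ∀ t ∈ Icc 0 h, ∀ x, ‖w t x‖ ≤ M) :
    ∀ s ∈ Ico 0 h, ∫⁻ x, ENNReal.ofReal (frobeniusNormSq (fderiv ℝ (w s) x)) ≤
      ENNReal.ofReal (Real.exp (2 * ((1 : ℝ) * (2 * (1 - (1 : ℝ))) ^ ((1 - (1 : ℝ)) / 1) *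
          (2 : ℝ) ^ (-(1 / (1 : ℝ))) *
          (SNormLESNormFDerivOfEqConst (EuclideanSpace ℝ (Fin 3))
            (volume : Measure (EuclideanSpace ℝ (Fin 3))) 2 : ℝ) ^ (2 * (1 - (1 : ℝ)) / 1)) *
          (ν / 2) ^ (1 - 2 / (1 : ℝ)) * (M ^ 2 * h))) *
        ((∫⁻ x, ENNReal.ofReal (frobeniusNormSq (fderiv ℝ (w 0) x))) +
          (ENNReal.ofReal ν)⁻¹ * ((C₀ : ℝ≥0∞) * ENNReal.ofReal h)) := by
  intro s hs'
  -- hypotheses of the tree theorem on the sub-slabs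
  have hsol : ∀ T' ∈ Ioo 0 h, IsClassicalNSSolutionOn (Icc 0 T') ν (fun s => f (s + t₀)) w q :=
    fun T' hT' => hw.mono (Icc_subset_Icc le_rfl hT'.2.le) (uniqueDiffOn_Icc hT'.1)
  have hu' : ∀ T' ∈ Ioo 0 h, HasBoundedSobolevNormsOn (Icc 0 T') w :=
    fun T' hT' => hwS.mono (Icc_subset_Icc le_rfl hT'.2.le)
  have hut : ∀ T' ∈ Ioo 0 h,
      HasBoundedSobolevNormsOn (Icc 0 T') (timeDerivWithin (Icc 0 T') w) := by
    intro T' hT' n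
    obtain ⟨C, hC⟩ := hwS' n
    refine ⟨C, fun t ht => ?_⟩
    rw [timeDerivWithin_sub_slab hw.smooth_velocity hT'.1 hT'.2.le ht]
    exact hC t ⟨ht.1, ht.2.trans hT'.2.le⟩
  have hp' : ∀ T' ∈ Ioo 0 h, ∀ n : ℕ, ∃ C : ℝ≥0, ∀ t ∈ Icc 0 T',
      ∫⁻ x, ‖iteratedFDeriv ℝ n (q t) x‖ₑ ^ 2 ≤ C := by
    intro T' hT' n
    obtain ⟨C, hC⟩ := hqS n
    exact ⟨C, fun t ht => hC t ⟨ht.1, ht.2.trans hT'.2.le⟩⟩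
  have hf' : ∀ T' ∈ Ioo 0 h, ∀ n : ℕ, n ≤ 1 → ∃ C : ℝ≥0, ∀ t ∈ Icc 0 T',
      ∫⁻ x, ‖iteratedFDeriv ℝ n ((fun s => f (s + t₀)) t) x‖ₑ ^ 2 ≤ C := by
    intro T' _ n hn
    rcases Nat.le_one_iff_eq_zero_or_eq_one.1 hn with rfl | rfl
    · exact ⟨C₀, fun t ht => by
        rw [← lintegral_enorm_sq_eq_iteratedFDeriv_zero]; exact hC₀ (t + t₀) (by linarith [ht.1])⟩
    · exact ⟨C₁, fun t ht => hC₁ (t + t₀) (by linarith [ht.1])⟩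
  have hFm : Measurable (fun _ : ℝ => (C₀ : ℝ≥0∞)) := measurable_const
  have hF : ∀ t ∈ Ioo 0 h, ∫⁻ x, ‖(fun s => f (s + t₀)) t x‖ₑ ^ 2 ≤ (fun _ : ℝ => (C₀ : ℝ≥0∞)) t :=
    fun t ht => hC₀ (t + t₀) (by linarith [ht.1])
  have hθ : (1 : ℝ) = 1 - (3 / (⊤ : ℝ≥0∞)).toReal := by simp
  -- the Serrin quantity at `r = ∞` is at most `M² h`
  have hAle : ∫⁻ t in Ioo 0 h, ENNReal.ofReal ((eLpNorm (w t) ⊤ volume).toReal ^ (2 / (1 : ℝ))) ≤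
      ENNReal.ofReal (M ^ 2 * h) := by
    have hpt : ∀ t ∈ Ioo 0 h, ENNReal.ofReal ((eLpNorm (w t) ⊤ volume).toReal ^ (2 / (1 : ℝ))) ≤
        ENNReal.ofReal (M ^ 2) := by
      intro t ht
      have h1 : (eLpNorm (w t) ⊤ volume).toReal ≤ M :=
        ENNReal.toReal_le_of_le_ofReal hM0 (eLpNorm_top_le_of_bound (hwM t ⟨ht.1.le, ht.2.le⟩))
      have h2 : (eLpNorm (w t) ⊤ volume).toReal ^ (2 / (1 : ℝ)) ≤ M ^ 2 := by
        rw [div_one, show (2 : ℝ) = ((2 : ℕ) : ℝ) by norm_num, Real.rpow_natCast]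
        exact pow_le_pow_left₀ ENNReal.toReal_nonneg h1 2
      exact ENNReal.ofReal_le_ofReal h2
    calc ∫⁻ t in Ioo 0 h, ENNReal.ofReal ((eLpNorm (w t) ⊤ volume).toReal ^ (2 / (1 : ℝ)))
        ≤ ∫⁻ _ in Ioo 0 h, ENNReal.ofReal (M ^ 2) := setLIntegral_mono' measurableSet_Ioo hpt
      _ = ENNReal.ofReal (M ^ 2 * h) := by
          rw [setLIntegral_const, Real.volume_Ioo, sub_zero, ← ENNReal.ofReal_mul (sq_nonneg M)]
  have hA : ∫⁻ t in Ioo 0 h, ENNReal.ofReal ((eLpNorm (w t) ⊤ volume).toReal ^ (2 / (1 : ℝ))) ≠ ⊤ :=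
    (hAle.trans_lt ENNReal.ofReal_lt_top).ne
  have hFT : ∫⁻ _ in Ioo 0 h, (C₀ : ℝ≥0∞) ≠ ⊤ := by
    rw [setLIntegral_const, Real.volume_Ioo, sub_zero]
    exact ENNReal.mul_ne_top ENNReal.coe_ne_top ENNReal.ofReal_ne_top
  have hG := enstrophy_le_of_serrin_forced_uniform hν hsol hu' hut hp' hf' (fun _ => (C₀ : ℝ≥0∞))
    hFm hF (r := ⊤) (by simp) hθ hA hFT s hs'
  refine hG.trans ?_
  have hint : ∫⁻ _ in Ioo 0 h, (C₀ : ℝ≥0∞) = (C₀ : ℝ≥0∞) * ENNReal.ofReal h := by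
    rw [setLIntegral_const, Real.volume_Ioo, sub_zero]
  rw [hint]
  gcongr
  · exact ENNReal.toReal_le_of_le_ofReal (by positivity) hAle

end Piece

/-! ## §3 The restart loop and the continuation past the slab -/

/-- Bookkeeping of the restart loop in `ℝ≥0∞`: with `e(x) = ofReal (exp x)`, rate `κ ≥ 0`,
`e(κ M² h) · (e(κ M² n h) (K₀ + n b) + b) ≤ e(κ M² (n+1) h) (K₀ + (n+1) b)`. [folklore] -/
theorem loop_step_bound {κ M h : ℝ} (hκ : 0 ≤ κ) (hh : 0 ≤ h) (K₀ b : ℝ≥0∞) (n : ℕ) :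
    ENNReal.ofReal (Real.exp (κ * (M ^ 2 * h))) *
        (ENNReal.ofReal (Real.exp (κ * (M ^ 2 * ((n : ℝ) * h)))) * (K₀ + (n : ℝ≥0∞) * b) + b) ≤
      ENNReal.ofReal (Real.exp (κ * (M ^ 2 * (((n + 1 : ℕ) : ℝ) * h)))) *
        (K₀ + ((n + 1 : ℕ) : ℝ≥0∞) * b) := by
  set en : ℝ≥0∞ := ENNReal.ofReal (Real.exp (κ * (M ^ 2 * ((n : ℝ) * h)))) with hen
  have hen1 : 1 ≤ en := by
    rw [hen, ← ENNReal.ofReal_one]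
    exact ENNReal.ofReal_le_ofReal (Real.one_le_exp (by positivity))
  have h1 : en * (K₀ + (n : ℝ≥0∞) * b) + b ≤ en * (K₀ + ((n + 1 : ℕ) : ℝ≥0∞) * b) := by
    calc en * (K₀ + (n : ℝ≥0∞) * b) + b
        ≤ en * (K₀ + (n : ℝ≥0∞) * b) + en * b := by
          gcongr
          calc b = 1 * b := (one_mul b).symm
            _ ≤ en * b := mul_le_mul_left hen1 b
      _ = en * (K₀ + ((n + 1 : ℕ) : ℝ≥0∞) * b) := by push_cast; ring
  have h2 : ENNReal.ofReal (Real.exp (κ * (M ^ 2 * h))) * en =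
      ENNReal.ofReal (Real.exp (κ * (M ^ 2 * (((n + 1 : ℕ) : ℝ) * h)))) := by
    rw [hen, ← ENNReal.ofReal_mul (Real.exp_nonneg _), ← Real.exp_add]
    congr 1
    push_cast
    ring_nf
  calc ENNReal.ofReal (Real.exp (κ * (M ^ 2 * h))) * (en * (K₀ + (n : ℝ≥0∞) * b) + b)
      ≤ ENNReal.ofReal (Real.exp (κ * (M ^ 2 * h))) * (en * (K₀ + ((n + 1 : ℕ) : ℝ≥0∞) * b)) :=
        mul_le_mul_right h1 _
    _ = ENNReal.ofReal (Real.exp (κ * (M ^ 2 * (((n + 1 : ℕ) : ℝ) * h)))) *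
        (K₀ + ((n + 1 : ℕ) : ℝ≥0∞) * b) := by rw [← mul_assoc, h2]

/-- The loop bound is uniform as long as `n h ≤ 2τ`:
`e(κ M² n h) (K₀ + n · ν⁻¹ C₀ h) ≤ e(κ M² (2τ)) (K₀ + ν⁻¹ C₀ (2τ))`. [folklore] -/
theorem loop_bound_le_uniform {κ M h τ ν : ℝ} (hκ : 0 ≤ κ) (K₀ : ℝ≥0∞) (C₀ : ℝ≥0)
    (n : ℕ) (hn : (n : ℝ) * h ≤ 2 * τ) :
    ENNReal.ofReal (Real.exp (κ * (M ^ 2 * ((n : ℝ) * h)))) *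
        (K₀ + (n : ℝ≥0∞) * ((ENNReal.ofReal ν)⁻¹ * ((C₀ : ℝ≥0∞) * ENNReal.ofReal h))) ≤
      ENNReal.ofReal (Real.exp (κ * (M ^ 2 * (2 * τ)))) *
        (K₀ + (ENNReal.ofReal ν)⁻¹ * ((C₀ : ℝ≥0∞) * ENNReal.ofReal (2 * τ))) := by
  have hnh : (n : ℝ≥0∞) * ENNReal.ofReal h = ENNReal.ofReal ((n : ℝ) * h) := by
    rw [← ENNReal.ofReal_natCast n, ← ENNReal.ofReal_mul (Nat.cast_nonneg n)]
  have h1 : ENNReal.ofReal (Real.exp (κ * (M ^ 2 * ((n : ℝ) * h)))) ≤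
      ENNReal.ofReal (Real.exp (κ * (M ^ 2 * (2 * τ)))) := by
    refine ENNReal.ofReal_le_ofReal (Real.exp_le_exp.2 ?_)
    exact mul_le_mul_of_nonneg_left (mul_le_mul_of_nonneg_left hn (sq_nonneg M)) hκ
  have h2 : (n : ℝ≥0∞) * ((ENNReal.ofReal ν)⁻¹ * ((C₀ : ℝ≥0∞) * ENNReal.ofReal h)) ≤
      (ENNReal.ofReal ν)⁻¹ * ((C₀ : ℝ≥0∞) * ENNReal.ofReal (2 * τ)) := by
    calc (n : ℝ≥0∞) * ((ENNReal.ofReal ν)⁻¹ * ((C₀ : ℝ≥0∞) * ENNReal.ofReal h))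
        = (ENNReal.ofReal ν)⁻¹ * ((C₀ : ℝ≥0∞) * ((n : ℝ≥0∞) * ENNReal.ofReal h)) := by ring
      _ ≤ (ENNReal.ofReal ν)⁻¹ * ((C₀ : ℝ≥0∞) * ENNReal.ofReal (2 * τ)) := by
        rw [hnh]; gcongr
  exact mul_le_mul' h1 (add_le_add le_rfl h2)


end ForcedContinuation

end Summit.NavierStokesRegularity.FluidComputer.PalasekTowerClayBridge

end
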